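import Literature.NumberTheory.EllipticCurves.Rank1Residual.Typed.PAdicCertificateMultiplicativeExists
import Literature.NumberTheory.EllipticCurves.LeadingTermPPartEisensteinProofs
import HarnessLib

/-!
# Rank `0` at a multiplicative prime: `BSD(E,p)` from the main-conjecture EQUALITY at `p ‖ N`, with NO numerical certificate (cell `b2b-bsdres`)

HONEST FRAMING (run/shared/lean/b2b/bsd-rank1-residual/, verbatim): the goal of the cell is to
DELETE the COMBINATION-SHAPED residual classes for ALL analytic-rank `≤ 1` elliptic curves over `ℚ`
— "full BSD formula for every rank `≤ 1` curve in class C" assembled STRICTLY from published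
theorems — so that the rank-`≤ 1` remainder becomes exactly the CONSTRUCTION-SHAPED classes, which
are TYPED (missing-input `Prop`s), NOT attempted. This is not "finishing BSD".

Theorems only (no definition, no new named fact; prover x11a gen 8). The multiplicative companion of
the good-ordinary rank-`0` glue `padicValRat_bsd_rank_zero_of_mazurMainConjecture`
(`LeadingTermPPartEisensteinProofs`): at a prime `p ‖ N` of analytic rank `0`, the EQUALITY
`char_Λ X(E/ℚ_∞) = (g)`, `ι(T^e · g · w) = ϖ · L` (`e = 1` split / `0` non-split, `w ∈ Λˣ`; the
conclusion shape of `Skinner2016.thmA_charIdeal_multiplicative` and of the Emerton–Pollack–Weston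
transfer `EmertonPollackWeston2006.MultiplicativeCharIdealMuZero`) gives the rank-`0` print shape
`ord_p(L(E,1)/Ω_E) = ord_p #Ш + ord_p ∏ c_v - 2 ord_p #E(ℚ)_tors` and hence `BSD(E,p)` — WITHOUT the
per-curve valuation certificate `hcert` of the engine theorems (`Typed/PAdicCertificate*.lean`) and
WITHOUT the hypothesis `p ∤ #Ш_an`: the equality of ideals replaces the one-sided divisibility, and
the analytic leading coefficient is known in closed form in rank `0`:
* non-split `p`: `L(0) = (1 - α⁻¹)[0]⁺_f = 2 [0]⁺_f` (`IsMultPAdicLFunctionOf.constantCoeff_of_neg_one`,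
  Mazur–Tate–Teitelbaum §I.14 with `ε(p) = 0`; Greenberg LNM 1716 §4 p. 113), against Jones's
  algebraic leading term `g(0) · #E(ℚ)_tors² = u · 2 · #Ш[p^∞] · Reg_p · ∏ c_v` (Stein–Wuthrich 2013
  Thm. 6.1, `SteinWuthrich2013.thm61_nonsplitMultiplicative`, with `Reg_p = 1` in rank `0`,
  `padicRegulator_eq_one_of_finite`);
* split `p`: the trivial zero — `[T¹]L · log_p κ(γ) = 𝓛_p · [0]⁺_f` (Greenberg–Stevens 1993, the
  named fact `greenberg_stevens` of `PAdicBSD.lean`) against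
  `g(0) · log_p κ(γ) · #E(ℚ)_tors² = u · 𝓛_p · #Ш[p^∞] · Reg_p · ∏ c_v`
  (`SteinWuthrich2013.thm61_splitMultiplicative`), the `𝓛`-invariant cancelling because `𝓛_p ≠ 0`
  (Barré-Sirieix–Diaz–Gramain–Philibert, named fact `LInvariant_ne_zero`).
Then `bsdp_of_padicValRat_rank_zero` (Miller's `BSD(E,p)` from the rank-`0` print shape; GZK).
The Stein–Wuthrich height datum is supplied by the existence facts
`SteinWuthrich2013.exists_isMultCanonical` / `exists_isSplitMultCanonical` (p182056).

This is, for `(E, p)` on the (ram) locus, a kernel PROOF of the rank-`0` half of Skinner 2016 Thm. C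
from his Thm. A + Stein–Wuthrich Thm. 6.1 + Greenberg–Stevens (`bsdp_of_thmA_{split,nonsplit}_rankZero`;
consistency check of the tree's separate named fact `Skinner2016.thmC_padicValRat_bsd_rank_zero`),
and, for a `¬ram` curve, the consumer of the Emerton–Pollack–Weston transfer
(`EmertonPollackWeston2006/HidaFamilyTransfer.lean`, x11a gen 8): X11 ∧ `r = 0` ∧ `¬ram(p)` with
`p ∣ #Ш_an` — the LAST class-level residue of X11 at `p ≥ 5` (`X11RankZero.MissingInputAt`, the
LOWER bound) — is reached by [a congruent partner curve where the main-conjecture identity with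
`μ = 0` is known] + [this file], see `X11RankZero.bsdp_of_multCharIdeal_{split,nonsplit}`.
Data conventions (cyclotomic `κ, γ`, newform `f`, dual datum `D`, period ratio `ϖ`, `L`, Tate
parameter) are those of `Typed/PAdicCertificateMultiplicativeCanonical.lean`. Nothing here changes a
verdict or a label (the lane certifies; the partner and its `μ = 0` certificate are per-curve inputs).

References: Skinner, Pacific J. Math. 283 (2016) Thm. A/C, §3.2–3.3 [Skinner2016PacificMC];
Stein–Wuthrich, Math. Comp. 82 (2013) Thm. 6.1, §4.2 [SteinWuthrich2013]; Greenberg–Stevens,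
Invent. Math. 111 (1993) [GreenbergStevens1993]; Mazur–Tate–Teitelbaum 1986 §I.14
[MazurTateTeitelbaum1986]; Greenberg, LNM 1716 §4 [GreenbergLNM1716]; Miller 2011 Def. 1.1
[Miller2011LMS]; Emerton–Pollack–Weston, Invent. Math. 163 (2006) Cor. 5.1.4 [EmertonPollackWeston2006].
-/

set_option autoImplicit false

noncomputable section

open scoped Classical MatrixGroups ModularForm

open CongruenceSubgroup WeierstrassCurve Literature.NumberTheory.EllipticCurves
  Literature.NumberTheory.EllipticCurves.ModularForms
  Literature.NumberTheory.EllipticCurves.Rank1Residual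
  Literature.NumberTheory.EllipticCurves.Skinner2016
  Literature.NumberTheory.EllipticCurves.Wuthrich2014
  Literature.NumberTheory.EllipticCurves.SteinWuthrich2013

namespace Literature.NumberTheory.EllipticCurves.Rank1Residual.Typed

/-! ### The algebraic step common to both cases -/

/-- Valuation bookkeeping: from `t · #E(ℚ)_tors² = v · #Ш[p^∞] · ∏ c_v` in `ℚ_p` with `v` a unit and
`t ≠ 0`, the rank-`0` print shape `ord_p t = ord_p #Ш + ord_p ∏ c_v - 2 ord_p #E(ℚ)_tors`
(`#Ш ∼ #Ш[p^∞]` up to a `p`-adic unit, `exists_unit_natCard_eq_mul_card_primaryComponent`).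
[folklore] -/
theorem padicValRat_eq_of_torsionSq_mul_eq (W : WeierstrassCurve ℚ) [W.IsElliptic] (p : ℕ)
    [Fact p.Prime] [Finite W.sha] {t : ℚ} (ht0 : t ≠ 0) (v : ℚ_[p]) (hv : v.valuation = 0)
    (hv0 : v ≠ 0)
    (key : (t : ℚ_[p]) * (W.torsionOrder : ℚ_[p]) ^ 2 =
      v * (Nat.card (AddCommGroup.primaryComponent W.sha p) : ℚ_[p]) * (W.tamagawaProduct : ℚ_[p])) :
    padicValRat p t = (padicValNat p W.shaOrder : ℤ) + padicValNat p W.tamagawaProduct -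
      2 * padicValNat p W.torsionOrder := by
  have hpP : p.Prime := Fact.out
  haveI : NeZero p := ⟨hpP.ne_zero⟩
  set Shp : ℚ_[p] := (Nat.card (AddCommGroup.primaryComponent W.sha p) : ℚ_[p]) with hShp
  obtain ⟨u₅, hu₅⟩ := exists_unit_natCard_eq_mul_card_primaryComponent W.sha p
  have hSha : (W.shaOrder : ℚ_[p]) = ((u₅ : ℤ_[p]) : ℚ_[p]) * Shp := by
    rw [WeierstrassCurve.shaOrder, hShp]
    exact hu₅
  have htQ0 : (t : ℚ_[p]) ≠ 0 := by exact_mod_cast ht0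
  have hT0 : (W.torsionOrder : ℚ_[p]) ≠ 0 := by
    exact_mod_cast (W.torsionOrder_pos W.finite_torsion_holds).ne'
  have hSha0 : (W.shaOrder : ℚ_[p]) ≠ 0 := by
    exact_mod_cast (WeierstrassCurve.shaOrder_pos W ‹_›).ne'
  have hc0 : (W.tamagawaProduct : ℚ_[p]) ≠ 0 := by
    exact_mod_cast (W.tamagawaProduct_pos_holds : 0 < W.tamagawaProduct).ne'
  have key' : (t : ℚ_[p]) * (W.torsionOrder : ℚ_[p]) ^ 2 * ((u₅ : ℤ_[p]) : ℚ_[p]) =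
      v * (W.shaOrder : ℚ_[p]) * (W.tamagawaProduct : ℚ_[p]) := by
    rw [hSha]
    linear_combination ((u₅ : ℤ_[p]) : ℚ_[p]) * key
  have hval := congrArg Padic.valuation key'
  rw [Padic.valuation_mul (mul_ne_zero htQ0 (pow_ne_zero 2 hT0)) (coe_units_ne_zero p u₅),
    Padic.valuation_mul htQ0 (pow_ne_zero 2 hT0), Padic.valuation_pow, valuation_coe_units_eq_zero,
    Padic.valuation_mul (mul_ne_zero hv0 hSha0) hc0, Padic.valuation_mul hv0 hSha0, hv,
    Padic.valuation_ratCast] at hval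
  simp only [Padic.valuation_natCast, Nat.cast_ofNat, add_zero, zero_add] at hval
  linarith

/-! ### Non-split multiplicative `p` -/

/-- **Rank `0`, NON-split multiplicative `p ≠ 2`: `BSD(E,p)` from the main-conjecture EQUALITY,
Jones's leading term and the interpolation `L(0) = 2[0]⁺_f` — no numerical certificate, `p ∣ #Ш_an`
allowed.** Inputs (all PUBLISHED named facts or tree theorems): Stein–Wuthrich 2013 Thm. 6.1 at a
non-split prime (`hJ`), existence of THE §4.2 height datum (`hH`), Gross–Zagier–Kolyvagin (`hGZK`:
rank `0` and `Ш` finite from `ord_{s=1} L(E,s) = 0`), modularity (`hmod`: `L(E,1) ≠ 0`); data: the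
Tate parameter `q`, the cyclotomic data, the newform `f`, a dual datum `D`, the period ratio
`ϖ ≠ 0` with `ϖ · Ω_E = Ω⁺_f`, THE non-split `p`-adic `L`-function `L`; and the EQUALITY `hMC` for
THIS data: `X` torsion, `char_Λ X = (g)`, `ι(g · w) = ϖ · L` with `w ∈ Λˣ` (supplied by Skinner
2016 Thm. A on the (ram) locus, or by the Emerton–Pollack–Weston transfer from a congruent partner).
Chain: `g(0)·w(0) = ϖ · L(0) = 2ϖ[0]⁺_f = 2 · L(E,1)/Ω_E`; Thm. 6.1 (rank `0`, `Reg_p = 1`, Schneider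
trivially true): `g(0) · #E(ℚ)_tors² = u · 2 · #Ш[p^∞] · ∏ c_v`; hence
`(L(E,1)/Ω_E) · #E(ℚ)_tors² = u·w(0) · #Ш[p^∞] · ∏ c_v`, valuations, `bsdp_of_padicValRat_rank_zero`.
[cite: SteinWuthrich2013, Thm. 6.1 (p. 20) and §4.2 (p. 15)] [cite: MazurTateTeitelbaum1986, §I.14]
[cite: GreenbergLNM1716, §4 (PDF p. 113)] [cite: Miller2011LMS, Def. 1.1 and §1] -/
theorem bsdp_of_multCharIdeal_nonsplit_rankZero (hJ : thm61_nonsplitMultiplicative)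
    (hH : exists_isMultCanonical) (hGZK : rank_eq_analyticRank_of_analyticRank_le_one)
    (hmod : hasEntireLFunction_rat)
    (W : WeierstrassCurve ℚ) [W.IsElliptic] [W.IsGloballyMinimal] (p : ℕ) [Fact p.Prime]
    {κ : ZpExtension ℚ p} {γ : Field.absoluteGaloisGroup ℚ} {N : ℕ} [NeZero N]
    {f : CuspForm (Gamma0 N) 2} (hp : p ≠ 2) (hr : W.analyticRank = 0)
    (hmult : W.HasMultiplicativeReductionAtPrime p)
    (hns : ¬ W.HasSplitMultiplicativeReductionAtPrime p)
    {q : ℚ_[p]} (hq0 : q ≠ 0) (hq1 : ‖q‖ < 1) (hqj : tateJ q = (W.j : ℚ_[p]))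
    (hκ : κ.IsCyclotomic) (hγ : κ.IsTopGenerator γ) (hγ' : IsCyclotomicVariable p γ)
    (hf : IsNewformOf W f) (D : W.SelmerDualData κ γ) (ϖ : ℚ) (hϖ0 : ϖ ≠ 0)
    (hϖ : (ϖ : ℝ) * W.realPeriodRat = plusPeriod f)
    (L : PowerSeries ℚ_[p]) (hL : IsMultPAdicLFunctionOf f p (-1) L)
    (hMC : D.IsTorsion ∧ ∃ (g : IwasawaAlgebra p) (w : (IwasawaAlgebra p)ˣ),
      D.charIdeal = Ideal.span {g} ∧
      iwasawaToPowerSeries p (g * (w : IwasawaAlgebra p)) = PowerSeries.C ((ϖ : ℚ) : ℚ_[p]) * L) :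
    BSDp W p := by
  have hpP : p.Prime := Fact.out
  haveI : Module.Finite (IwasawaAlgebra p) D.X := D.module_finite_holds hγ
  obtain ⟨hX, g, w, hchar, hw⟩ := hMC
  -- `L(E,1) ≠ 0`, rank `0`, `Ш` finite, `E(ℚ)` finite
  have hL1 : W.entireLFunction 1 ≠ 0 := (W.analyticRank_eq_zero_iff_holds (hmod W)).1 hr
  obtain ⟨hrank, hfin⟩ := hGZK W (by omega)
  have hr0 : W.mordellWeilRank = 0 := by rw [hrank, hr]
  haveI : Finite W.toAffine.Point := W.mordellWeilRank_eq_zero_iff_finite.mp hr0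
  haveI : Finite W.sha := hfin
  haveI : Finite (AddCommGroup.primaryComponent W.sha p) := inferInstance
  -- the rational `t = ϖ · [0]⁺_f = L(E,1)/Ω_E`
  set s : ℚ := ratPlusSymbol f 0 with hs_def
  set t : ℚ := ϖ * s with ht_def
  have hΩpos : 0 < W.realPeriodRat := W.realPeriodRat_pos_holds
  have hLval : W.entireLFunction 1 = (((s : ℝ) * plusPeriod f : ℝ) : ℂ) := hf.entireLFunction_one_eq
  have hq : W.entireLFunction 1 / (W.realPeriodRat : ℂ) = ((t : ℚ) : ℂ) := by
    rw [hLval, ← hϖ, div_eq_iff (Complex.ofReal_ne_zero.mpr hΩpos.ne'), ht_def]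
    push_cast
    ring
  have hs0 : s ≠ 0 := by
    intro h0
    apply hL1
    rw [hLval, h0]
    simp
  have ht0 : t ≠ 0 := mul_ne_zero hϖ0 hs0
  -- THE height datum; Schneider's non-degeneracy is trivial in rank `0` (`Reg_p = 1`)
  obtain ⟨Dh, hDh⟩ := hH W p hp hmult hns q hq0 hq1 hqj
  have hReg : padicRegulator Dh = 1 := padicRegulator_eq_one_of_finite W p Dh
  have hSch : SchneiderConjecture Dh := by
    rw [SchneiderConjecture, hReg]
    exact one_ne_zero
  -- Stein–Wuthrich Thm. 6.1, clause 3, in rank `0`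
  obtain ⟨-, -, h3⟩ := hJ W p hp hmult hns q hq0 hq1 hqj κ γ hκ hγ hγ' D hX g hchar Dh hDh
  obtain ⟨u, hu⟩ := h3 hSch inferInstance
  simp only [hr0, pow_zero, mul_one, hReg, PowerSeries.coeff_zero_eq_constantCoeff] at hu
  -- constant coefficients of `ι(g · w) = ϖ · L`: `g(0) · w(0) = ϖ · 2 [0]⁺_f`
  have hL0 : PowerSeries.constantCoeff L = 2 * (s : ℚ_[p]) := hL.constantCoeff_of_neg_one
  have hgw : PowerSeries.constantCoeff (g * (w : IwasawaAlgebra p)) =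
      PowerSeries.constantCoeff g * PowerSeries.constantCoeff (w : IwasawaAlgebra p) := map_mul _ _ _
  have h0 := congrArg PowerSeries.constantCoeff hw
  rw [constantCoeff_iwasawaToPowerSeries, hgw, PadicInt.coe_mul, map_mul,
    PowerSeries.constantCoeff_C, hL0] at h0
  -- `w(0)` is a unit of `ℤ_p`
  have hwu : IsUnit (PowerSeries.constantCoeff (w : IwasawaAlgebra p)) :=
    PowerSeries.isUnit_constantCoeff _ w.isUnit
  set w0 : ℤ_[p]ˣ := hwu.unit with hw0_def
  have hw0 : ((w0 : ℤ_[p]) : ℚ_[p]) = ((PowerSeries.constantCoeff (w : IwasawaAlgebra p) : ℤ_[p]) : ℚ_[p]) := by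
    rw [hw0_def, IsUnit.unit_spec]
  have htcast : ((t : ℚ) : ℚ_[p]) = (ϖ : ℚ_[p]) * (s : ℚ_[p]) := by
    rw [ht_def]; push_cast; ring
  -- the identity `t · #tors² = (u · w0) · #Ш[p^∞] · ∏ c_v`
  have key : (t : ℚ_[p]) * (W.torsionOrder : ℚ_[p]) ^ 2 =
      (((u : ℤ_[p]) : ℚ_[p]) * ((w0 : ℤ_[p]) : ℚ_[p])) *
        (Nat.card (AddCommGroup.primaryComponent W.sha p) : ℚ_[p]) * (W.tamagawaProduct : ℚ_[p]) := by
    apply mul_left_cancel₀ (two_ne_zero : (2 : ℚ_[p]) ≠ 0)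
    rw [htcast, hw0]
    linear_combination ((PowerSeries.constantCoeff (w : IwasawaAlgebra p) : ℤ_[p]) : ℚ_[p]) * hu -
      (W.torsionOrder : ℚ_[p]) ^ 2 * h0
  have hval := padicValRat_eq_of_torsionSq_mul_eq W p ht0 _
    (by rw [Padic.valuation_mul (coe_units_ne_zero p u) (coe_units_ne_zero p w0),
      valuation_coe_units_eq_zero, valuation_coe_units_eq_zero, add_zero])
    (mul_ne_zero (coe_units_ne_zero p u) (coe_units_ne_zero p w0)) key
  exact bsdp_of_padicValRat_rank_zero W p hr hL1 hGZK ⟨t, hq, hval⟩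

/-! ### Split multiplicative `p` -/

/-- **Rank `0`, SPLIT multiplicative `p ≠ 2`: `BSD(E,p)` from the main-conjecture EQUALITY,
Jones's leading term, Greenberg–Stevens and `𝓛_p ≠ 0` — no numerical certificate, `p ∣ #Ш_an`
allowed.** Inputs: Stein–Wuthrich 2013 Thm. 6.1 at a split prime (`hJ`), existence of THE §4.2 height
datum (`hH`), Greenberg–Stevens (`hGS`: `L(0) = 0`, `[T¹]L · log_p κ(γ) = 𝓛_p · [0]⁺_f`),
Barré-Sirieix–Diaz–Gramain–Philibert (`h𝓛`: `𝓛_p ≠ 0`), GZK (`hGZK`), modularity (`hmod`); data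
as in the non-split case with the Tate parameter datum `Dq` and THE split `p`-adic `L`-function `L`;
and the EQUALITY `hMC`: `X` torsion, `char_Λ X = (g)`, `ι(T · g · w) = ϖ · L`, `w ∈ Λˣ`.
Chain: `[T¹]ι(T·g·w) = g(0)·w(0) = ϖ · [T¹]L`, so `g(0)·w(0)·log κ(γ) = 𝓛_p · ϖ[0]⁺_f`;
Thm. 6.1 (rank `0`, `Reg_p = 1`): `g(0) · log κ(γ) · #E(ℚ)_tors² = u · 𝓛_p · #Ш[p^∞] · ∏ c_v`;
cancel `𝓛_p`. [cite: SteinWuthrich2013, Thm. 6.1 (p. 20) and §4.2 (pp. 15–16)]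
[cite: GreenbergStevens1993, Thm. (trivial zero)] [cite: MazurTateTeitelbaum1986, §I.14–I.15]
[cite: Miller2011LMS, Def. 1.1 and §1] -/
theorem bsdp_of_multCharIdeal_split_rankZero (hJ : thm61_splitMultiplicative)
    (hH : exists_isSplitMultCanonical) (hGZK : rank_eq_analyticRank_of_analyticRank_le_one)
    (hmod : hasEntireLFunction_rat)
    (W : WeierstrassCurve ℚ) [W.IsElliptic] [W.IsGloballyMinimal] (p : ℕ) [Fact p.Prime]
    (hGS : greenberg_stevens (W := W) (p := p)) (h𝓛 : LInvariant_ne_zero (W := W) (p := p))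
    {κ : ZpExtension ℚ p} {γ : Field.absoluteGaloisGroup ℚ} {N : ℕ} [NeZero N]
    {f : CuspForm (Gamma0 N) 2} (hp : p ≠ 2) (hr : W.analyticRank = 0)
    (Dq : TateParameterData W p)
    (hκ : κ.IsCyclotomic) (hγ : κ.IsTopGenerator γ) (hγ' : IsCyclotomicVariable p γ)
    (hf : IsNewformOf W f) (D : W.SelmerDualData κ γ) (ϖ : ℚ) (hϖ0 : ϖ ≠ 0)
    (hϖ : (ϖ : ℝ) * W.realPeriodRat = plusPeriod f)
    (L : PowerSeries ℚ_[p]) (hL : IsSplitMultPAdicLFunctionOf f p L)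
    (hMC : D.IsTorsion ∧ ∃ (g : IwasawaAlgebra p) (w : (IwasawaAlgebra p)ˣ),
      D.charIdeal = Ideal.span {g} ∧
      iwasawaToPowerSeries p ((PowerSeries.X : IwasawaAlgebra p) * g * (w : IwasawaAlgebra p)) =
        PowerSeries.C ((ϖ : ℚ) : ℚ_[p]) * L) :
    BSDp W p := by
  have hpP : p.Prime := Fact.out
  haveI : Module.Finite (IwasawaAlgebra p) D.X := D.module_finite_holds hγ
  obtain ⟨hX, g, w, hchar, hw⟩ := hMC
  have hL1 : W.entireLFunction 1 ≠ 0 := (W.analyticRank_eq_zero_iff_holds (hmod W)).1 hr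
  obtain ⟨hrank, hfin⟩ := hGZK W (by omega)
  have hr0 : W.mordellWeilRank = 0 := by rw [hrank, hr]
  haveI : Finite W.toAffine.Point := W.mordellWeilRank_eq_zero_iff_finite.mp hr0
  haveI : Finite W.sha := hfin
  haveI : Finite (AddCommGroup.primaryComponent W.sha p) := inferInstance
  set s : ℚ := ratPlusSymbol f 0 with hs_def
  set t : ℚ := ϖ * s with ht_def
  have hΩpos : 0 < W.realPeriodRat := W.realPeriodRat_pos_holds
  have hLval : W.entireLFunction 1 = (((s : ℝ) * plusPeriod f : ℝ) : ℂ) := hf.entireLFunction_one_eq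
  have hq : W.entireLFunction 1 / (W.realPeriodRat : ℂ) = ((t : ℚ) : ℂ) := by
    rw [hLval, ← hϖ, div_eq_iff (Complex.ofReal_ne_zero.mpr hΩpos.ne'), ht_def]
    push_cast
    ring
  have hs0 : s ≠ 0 := by
    intro h0
    apply hL1
    rw [hLval, h0]
    simp
  have ht0 : t ≠ 0 := mul_ne_zero hϖ0 hs0
  -- THE height datum at the split prime; `Reg_p = 1`
  obtain ⟨Dh, hDh⟩ := hH W p hp Dq
  have hReg : padicRegulator Dh = 1 := padicRegulator_eq_one_of_finite W p Dh
  have hSch : SchneiderConjecture Dh := by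
    rw [SchneiderConjecture, hReg]
    exact one_ne_zero
  -- Stein–Wuthrich Thm. 6.1 (split), clause 3, in rank `0`
  obtain ⟨-, -, h3⟩ := hJ W p hp Dq κ γ hκ hγ hγ' D hX g hchar Dh hDh
  obtain ⟨u, hu⟩ := h3 hSch inferInstance
  simp only [hr0, zero_add, pow_one, hReg, mul_one, PowerSeries.coeff_zero_eq_constantCoeff] at hu
  -- Greenberg–Stevens: `[T¹]L · log = 𝓛 · [0]⁺_f`
  obtain ⟨-, hGS1⟩ := hGS Dq hf hL
  -- `[T¹] ι(T·g·w) = g(0)·w(0)`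
  have hgw : PowerSeries.constantCoeff (g * (w : IwasawaAlgebra p)) =
      PowerSeries.constantCoeff g * PowerSeries.constantCoeff (w : IwasawaAlgebra p) := map_mul _ _ _
  have h1 : ((PowerSeries.constantCoeff g : ℤ_[p]) : ℚ_[p]) *
      ((PowerSeries.constantCoeff (w : IwasawaAlgebra p) : ℤ_[p]) : ℚ_[p]) =
        ((ϖ : ℚ) : ℚ_[p]) * PowerSeries.coeff 1 L := by
    have h := congrArg (PowerSeries.coeff 1) hw
    rw [show (PowerSeries.X : IwasawaAlgebra p) * g * (w : IwasawaAlgebra p) =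
        PowerSeries.X * (g * (w : IwasawaAlgebra p)) from mul_assoc _ _ _] at h
    rw [iwasawaToPowerSeries, PowerSeries.coeff_map, PowerSeries.coeff_succ_X_mul,
      PowerSeries.coeff_zero_eq_constantCoeff, hgw, PowerSeries.coeff_C_mul, map_mul] at h
    exact h
  -- `w(0)` is a unit of `ℤ_p`
  have hwu : IsUnit (PowerSeries.constantCoeff (w : IwasawaAlgebra p)) :=
    PowerSeries.isUnit_constantCoeff _ w.isUnit
  set w0 : ℤ_[p]ˣ := hwu.unit with hw0_def
  have hw0 : ((w0 : ℤ_[p]) : ℚ_[p]) = ((PowerSeries.constantCoeff (w : IwasawaAlgebra p) : ℤ_[p]) : ℚ_[p]) := by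
    rw [hw0_def, IsUnit.unit_spec]
  have htcast : ((t : ℚ) : ℚ_[p]) = (ϖ : ℚ_[p]) * (s : ℚ_[p]) := by
    rw [ht_def]; push_cast; ring
  have h𝓛0 : LInvariant Dq ≠ 0 := h𝓛 Dq
  -- the identity `t · #tors² = (u · w0) · #Ш[p^∞] · ∏ c_v`
  have key : (t : ℚ_[p]) * (W.torsionOrder : ℚ_[p]) ^ 2 =
      (((u : ℤ_[p]) : ℚ_[p]) * ((w0 : ℤ_[p]) : ℚ_[p])) *
        (Nat.card (AddCommGroup.primaryComponent W.sha p) : ℚ_[p]) * (W.tamagawaProduct : ℚ_[p]) := by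
    apply mul_left_cancel₀ h𝓛0
    rw [htcast, hw0]
    linear_combination (-(((ϖ : ℚ) : ℚ_[p]) * (W.torsionOrder : ℚ_[p]) ^ 2)) * hGS1 -
      (padicLog p (cyclotomicGenerator p) * (W.torsionOrder : ℚ_[p]) ^ 2) * h1 +
      ((PowerSeries.constantCoeff (w : IwasawaAlgebra p) : ℤ_[p]) : ℚ_[p]) * hu
  have hval := padicValRat_eq_of_torsionSq_mul_eq W p ht0 _
    (by rw [Padic.valuation_mul (coe_units_ne_zero p u) (coe_units_ne_zero p w0),
      valuation_coe_units_eq_zero, valuation_coe_units_eq_zero, add_zero])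
    (mul_ne_zero (coe_units_ne_zero p u) (coe_units_ne_zero p w0)) key
  exact bsdp_of_padicValRat_rank_zero W p hr hL1 hGZK ⟨t, hq, hval⟩

/-! ### Instances: Skinner 2016 Thm. A on the (ram) locus (the multiplicative half of his Thm. C, DERIVED) -/

/-- **Rank `0`, non-split multiplicative `p ≥ 3`, (irr) + (ram): `BSD(E,p)` from Skinner 2016
Thm. A (`hA`, PUBLISHED) composed with the rank-`0` glue** — i.e. the multiplicative half of the
conclusion of Skinner's Thm. C (tree: the separate named fact
`Skinner2016.thmC_padicValRat_bsd_rank_zero`), here DERIVED in the kernel from Thm. A +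
Stein–Wuthrich Thm. 6.1 + the interpolation property (consistency check; no certificate, `p ∣ #Ш_an`
allowed). Data: Tate parameter, cyclotomic data, newform, dual datum, period ratio, THE non-split
`p`-adic `L`-function. NOT an X11 theorem ((ram) is the complement of X11's rank-`0` clause).
[cite: Skinner2016PacificMC, Thm. A (§1), §3.2, §3.3, Thm. C] [cite: SteinWuthrich2013, Thm. 6.1 (p. 20)]
[cite: MazurTateTeitelbaum1986, §I.14] -/
theorem bsdp_of_thmA_nonsplit_rankZero (hA : thmA_charIdeal_multiplicative)
    (hJ : thm61_nonsplitMultiplicative) (hH : exists_isMultCanonical)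
    (hGZK : rank_eq_analyticRank_of_analyticRank_le_one) (hmod : hasEntireLFunction_rat)
    (W : WeierstrassCurve ℚ) [W.IsElliptic] [W.IsGloballyMinimal] (p : ℕ) [Fact p.Prime]
    {κ : ZpExtension ℚ p} {γ : Field.absoluteGaloisGroup ℚ} {N : ℕ} [NeZero N]
    {f : CuspForm (Gamma0 N) 2} (hp : 3 ≤ p) (hr : W.analyticRank = 0)
    (hmult : W.HasMultiplicativeReductionAtPrime p)
    (hns : ¬ W.HasSplitMultiplicativeReductionAtPrime p) (hirr : W.HasIrreducibleModPGaloisRep p)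
    (hram : Ram W p) {q : ℚ_[p]} (hq0 : q ≠ 0) (hq1 : ‖q‖ < 1) (hqj : tateJ q = (W.j : ℚ_[p]))
    (hκ : κ.IsCyclotomic) (hγ : κ.IsTopGenerator γ) (hγ' : IsCyclotomicVariable p γ)
    (hf : IsNewformOf W f) (D : W.SelmerDualData κ γ) (ϖ : ℚ) (hϖ0 : ϖ ≠ 0)
    (hϖ : (ϖ : ℝ) * W.realPeriodRat = plusPeriod f)
    (L : PowerSeries ℚ_[p]) (hL : IsMultPAdicLFunctionOf f p (-1) L) : BSDp W p := by
  refine bsdp_of_multCharIdeal_nonsplit_rankZero hJ hH hGZK hmod W p (by omega) hr hmult hns hq0 hq1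
    hqj hκ hγ hγ' hf D ϖ hϖ0 hϖ L hL ?_
  obtain ⟨htors, g, hchar, -, hnsp⟩ := hA W p hp hmult hirr hram hκ hγ hγ' hf D ϖ hϖ0 hϖ
  obtain ⟨w, hw⟩ := hnsp hns L hL
  exact ⟨htors, g, w, hchar, hw⟩

/-- **Rank `0`, split multiplicative `p ≥ 3`, (irr) + (ram): `BSD(E,p)` from Skinner 2016 Thm. A
(`hA`) composed with the rank-`0` glue** (Stein–Wuthrich Thm. 6.1, Greenberg–Stevens, `𝓛_p ≠ 0`) —
the split-multiplicative half of Thm. C's conclusion, DERIVED. No certificate; `p ∣ #Ш_an` allowed.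
NOT an X11 theorem. [cite: Skinner2016PacificMC, Thm. A (§1), §3.2, §3.3, Thm. C]
[cite: SteinWuthrich2013, Thm. 6.1 (p. 20)] [cite: GreenbergStevens1993, Thm. (trivial zero)] -/
theorem bsdp_of_thmA_split_rankZero (hA : thmA_charIdeal_multiplicative)
    (hJ : thm61_splitMultiplicative) (hH : exists_isSplitMultCanonical)
    (hGZK : rank_eq_analyticRank_of_analyticRank_le_one) (hmod : hasEntireLFunction_rat)
    (W : WeierstrassCurve ℚ) [W.IsElliptic] [W.IsGloballyMinimal] (p : ℕ) [Fact p.Prime]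
    (hGS : greenberg_stevens (W := W) (p := p)) (h𝓛 : LInvariant_ne_zero (W := W) (p := p))
    {κ : ZpExtension ℚ p} {γ : Field.absoluteGaloisGroup ℚ} {N : ℕ} [NeZero N]
    {f : CuspForm (Gamma0 N) 2} (hp : 3 ≤ p) (hr : W.analyticRank = 0)
    (hirr : W.HasIrreducibleModPGaloisRep p) (hram : Ram W p) (Dq : TateParameterData W p)
    (hκ : κ.IsCyclotomic) (hγ : κ.IsTopGenerator γ) (hγ' : IsCyclotomicVariable p γ)
    (hf : IsNewformOf W f) (D : W.SelmerDualData κ γ) (ϖ : ℚ) (hϖ0 : ϖ ≠ 0)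
    (hϖ : (ϖ : ℝ) * W.realPeriodRat = plusPeriod f)
    (L : PowerSeries ℚ_[p]) (hL : IsSplitMultPAdicLFunctionOf f p L) : BSDp W p := by
  refine bsdp_of_multCharIdeal_split_rankZero hJ hH hGZK hmod W p hGS h𝓛 (by omega) hr Dq hκ hγ hγ'
    hf D ϖ hϖ0 hϖ L hL ?_
  obtain ⟨htors, g, hchar, hsp, -⟩ :=
    hA W p hp Dq.split.hasMultiplicativeReductionAtPrime hirr hram hκ hγ hγ' hf D ϖ hϖ0 hϖ
  obtain ⟨w, hw⟩ := hsp Dq.split L hL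
  exact ⟨htors, g, w, hchar, hw⟩

end Literature.NumberTheory.EllipticCurves.Rank1Residual.Typed
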